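import Literature.NumberTheory.GaloisRepresentations.ContinuousH1
import HarnessLib

/-!
# A class of `H¹(G, X)` whose restriction to a normal subgroup `N` vanishes is killed by every
# integer killing `X^N` (the inflation half of inflation–restriction, torsion form; proofs only)

Topic `NumberTheory/GaloisRepresentations`; namespace `Literature.NumberTheory.GaloisRepresentations`.
Theorems only (D-0026), generic cocycle algebra on the tree's continuous crossed homomorphisms
(`ContinuousH1.lean`: `contOneCocycles`, `oneCocycleClass`, `oneCocycleClass_eq_zero_iff`).

For a topological representation `X` of `G` over `R`, a NORMAL subgroup `N ⊴ G` and a continuous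
1-cocycle `φ` whose restriction to `N` is a coboundary (`φ h = h v − v` on `N`) — i.e. whose class lies
in `ker (H¹(G, X) → H¹(N, X)) = Im (H¹(G/N, X^N) → H¹(G, X))` — the normalised values
`φ(g) − (g v − v)` lie in the invariants `X^N` (`contOneCocycles.apply_sub_mem_invariants_of_restrict`:
compare `φ(hg) = φ(h) + hφ(g)` with `φ(g · g⁻¹hg)`). Hence **every `n` with `n · X^N = 0` kills the
class**: `n · [φ] = 0` (`nsmul_oneCocycleClass_eq_zero_of_restrict_coboundary`), since `n·φ` is then the
coboundary of `n·v`. This is the torsion statement one extracts from the exactness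
`0 → H¹(G/N, X^N) → H¹(G, X) → H¹(N, X)` (Serre, *Galois Cohomology*, I §2.6 (b); Neukirch–Schmidt–Wingberg
(1.6.7)) without forming `H¹(G/N, X^N)`. Typed for the twisted Poitou–Tate lifting of cell `bsd-2adic`
(HOME/t42/DESIGN-T42-ADDENDUM-16.md, brick (β)(b): `N = Gal(ℚ̄/ℚ_∞)`, `X = E[2^J](χ_u)`,
`X^N ⊆ E(ℚ_∞)[2^∞]` finite of bounded exponent), but stated in general.

References: J.-P. Serre, *Galois Cohomology* (1997), I §2.6 (b), §5.8 [SerreGaloisCohomology1997];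
J. Neukirch, A. Schmidt, K. Wingberg, *Cohomology of Number Fields* (2008), (1.6.6)–(1.6.7)
[NeukirchSchmidtWingberg2008].
-/

noncomputable section

universe u v

namespace Literature.NumberTheory.GaloisRepresentations

open _root_.TopRep

variable {R : Type u} [CommRing R] [TopologicalSpace R]
variable {G : Type v} [Group G] [TopologicalSpace G] [IsTopologicalGroup G]
variable {X : TopRep.{v} R G}

omit [IsTopologicalGroup G] in
/-- **The normalised values of a cocycle principal on a normal subgroup `N` are `N`-invariant**: if
`φ h = h·v − v` for all `h ∈ N` then `h · (φ(g) − (g·v − v)) = φ(g) − (g·v − v)` for `h ∈ N`, `g ∈ G`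
(compare `φ(hg) = φ(h) + hφ(g)` with `φ(g · g⁻¹hg) = φ(g) + gφ(g⁻¹hg)`). [cite: SerreGaloisCohomology1997, I §2.6 (b)] -/
theorem contOneCocycles.apply_sub_mem_invariants_of_restrict (φ : contOneCocycles X)
    {N : Subgroup G} [N.Normal] (v : X) (hφ : ∀ h ∈ N, φ.1 h = X.ρ h v - v) {h : G} (hh : h ∈ N)
    (g : G) : X.ρ h (φ.1 g - (X.ρ g v - v)) = φ.1 g - (X.ρ g v - v) := by
  have hn : g⁻¹ * h * g ∈ N := by
    have := Subgroup.Normal.conj_mem inferInstance h hh g⁻¹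
    rwa [inv_inv] at this
  have h1 := φ.2 h g
  have h2 := φ.2 g (g⁻¹ * h * g)
  have hprod : g * (g⁻¹ * h * g) = h * g := by
    rw [← mul_assoc, ← mul_assoc, mul_inv_cancel, one_mul]
  have hmul : ∀ (a b : G) (x : X), X.ρ (a * b) x = X.ρ a (X.ρ b x) := fun a b x ↦ by
    rw [map_mul]; rfl
  rw [hprod, h1, hφ h hh, hφ _ hn, map_sub, ← hmul, hprod, hmul] at h2
  -- `h2 : h•v − v + h•φ g = φ g + (h•(g•v) − g•v)`
  rw [map_sub, map_sub]
  have h3 : X.ρ h (φ.1 g) = φ.1 g + (X.ρ h (X.ρ g v) - X.ρ g v) - (X.ρ h v - v) := by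
    rw [← h2]; abel
  rw [h3]
  abel

/-- **Inflation–restriction, torsion form: `n · [φ] = 0` when `φ|_N` is a coboundary and `n · X^N = 0`.**
If the restriction of the continuous cocycle `φ` to the normal subgroup `N` is a coboundary
(`φ h = h·v − v`, so `[φ] ∈ ker (H¹(G, X) → H¹(N, X))`) and `n` kills the invariants `X^N`, then
`n · φ` is the coboundary of `n · v`, so `n · [φ] = 0` in `H¹(G, X)`.
[cite: SerreGaloisCohomology1997, I §2.6 (b)] [cite: NeukirchSchmidtWingberg2008, (1.6.7)] -/
theorem nsmul_oneCocycleClass_eq_zero_of_restrict_coboundary (φ : contOneCocycles X)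
    {N : Subgroup G} [N.Normal] (v : X) (hφ : ∀ h ∈ N, φ.1 h = X.ρ h v - v) (n : ℕ)
    (hn : ∀ x : X, (∀ h ∈ N, X.ρ h x = x) → n • x = 0) :
    n • oneCocycleClass X φ = 0 := by
  have hval : ∀ g, n • φ.1 g = X.ρ g (n • v) - n • v := fun g ↦ by
    have h0 := hn _ fun h hh ↦ contOneCocycles.apply_sub_mem_invariants_of_restrict φ v hφ hh g
    rw [smul_sub, sub_eq_zero, smul_sub] at h0
    rw [h0, map_nsmul]
  rw [← Nat.cast_smul_eq_nsmul R n (oneCocycleClass X φ), ← oneCocycleClass_smul,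
    oneCocycleClass_eq_zero_iff]
  refine ⟨n • v, fun g ↦ ?_⟩
  rw [Submodule.coe_smul, ContinuousMap.smul_apply, Nat.cast_smul_eq_nsmul]
  exact hval g

/-- The special case `v = 0`: **a cocycle VANISHING on `N` has class killed by every `n` with
`n · X^N = 0`** (its values are `N`-invariant). [cite: SerreGaloisCohomology1997, I §2.6 (b)] -/
theorem nsmul_oneCocycleClass_eq_zero_of_vanish_on_normal (φ : contOneCocycles X) {N : Subgroup G}
    [N.Normal] (hφ : ∀ h ∈ N, φ.1 h = 0) (n : ℕ)
    (hn : ∀ x : X, (∀ h ∈ N, X.ρ h x = x) → n • x = 0) :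
    n • oneCocycleClass X φ = 0 :=
  nsmul_oneCocycleClass_eq_zero_of_restrict_coboundary φ 0
    (fun h hh ↦ by rw [hφ h hh, map_zero, sub_zero]) n hn

end Literature.NumberTheory.GaloisRepresentations

end
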